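import Literature.Geometry.DiscreteGeometry.TammesTwelveIcosahedron

/-!
# Schütte–van der Waerden's arrangement of nine points (`cos a₉ = 1/3`, `70°32′`), the monotonicity
# `d_{N+1} ≤ d_N`, and the rows `N = 9, 10, 11` of the Tammes table — proved

Topic `Literature/Geometry/DiscreteGeometry`.  Theorem-only companion of `RankinSimplexBound.lean`
(Tammes rows `N = 2, …, 6`), `TammesSevenEightConfigurations.lean` (`N = 7, 8`, achievability),
`FejesTothTammesEight.lean`, `TammesTwelveIcosahedron.lean` (`N = 12`) and
`FejesTothTammesBound.lean` (L. Fejes Tóth's bound, all `N`), in the vocabulary of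
`SphericalCodeOptimal.lean` (`maxMinDist N E` = the chordal Tammes number `d_N`, the largest
minimum distance of `N` points of the unit sphere of `E`).

## Sources, AS PRINTED

* K. Schütte, B. L. van der Waerden, Math. Ann. 123 (1951) 96–124 [`SchutteVanderwaerden1951`],
  read from the open GDZ scan PPN235181684_0123.  Normalisation (p. 100 (1), pp. 101–102): minimum
  distance `1` on a sphere of radius `r`, `a` = the arc between two points at distance `1`,
  `sin (a/2) = 1/(2r)`; the §18 table (p. 124) lists `d² = 4r²`.  In the unit-sphere chordal
  convention of this tree the Tammes value is `2 sin (a_N/2) = 2/d = √(2 − 2 cos a_N)`.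
  **§12 "Eine Lagerung von 9 Punkten auf der Kugel" (p. 110, Fig. 24):** "Wir gehen aus von einem
  gleichseitigen Dreieck `ABC` der Seitenlänge 1. Diesem wird eine Kugel umbeschrieben, so daß die
  Eckpunkte des Dreiecks auf dem Äquator liegen. Auf den Seiten dieses Dreiecks wird nach oben und
  nach unten je ein weiteres gleichseitiges Dreieck der Seitenlänge 1 errichtet, so daß die
  gegenüberliegenden Ecken `P, Q, R` bzw. `L, M, N` je auf einem Breitenkreis liegen. […] Nun nehmen
  wir eine stetige Vergrößerung der Kugel unter Erhaltung ihres Mittelpunktes vor. Die Punkte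
  `A, B, C` sollen dabei ihre Richtungen zum Mittelpunkt beibehalten, also auf dem Äquator
  verbleiben. […] Die stetige Vergrößerung der Kugel soll nun so weit durchgeführt werden, bis
  diese Abstände genau gleich 1 geworden sind. Wir erhalten so eine störungsfreie Lagerung von 9
  Punkten auf einer Kugel (Fig. 24). In dem entsprechenden Graphen haben alle Punkte 4. Grad. Es
  treten 8 Dreiecke und 3 kongruente sphärische Rhomben auf. […] `2α₀ + 2γ₀ = 360°`,
  `3α₀ + δ₀ = 360°`. […] Man erhält: `cos α₀ = ¼; cos a₀ = ⅓; r₀ = ½√3`."  §18 table (p. 124):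
  `N = 9 | d² = 3`.  (§§13–16, pp. 111–121, prove that this is the minimal sphere for `N = 9`:
  "So blieb schließlich nur die in § 12 gefundene, in Fig. 24 dargestellte Möglichkeit übrig"
  (p. 97) — the MINIMALITY is NOT formalised here.)  **§17, p. 122:** "Für `N = 12` ist die dem
  Ikosaeder der Kantenlänge 1 umbeschriebene Kugel die Minimalkugel. Diese stellt wahrscheinlich
  auch die Minimalkugel für `N = 11` dar."  (Proved later by Böröczky 1983 / Danzer 1986 — not
  formalised here.)
* H. T. Croft, K. J. Falconer, R. K. Guy, *Unsolved Problems in Geometry* (1991), §D7 p. 129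
  [`CroftFalconerGuy1991`]: the table "`9 | 70°32′ | (unique configuration)`", "`10 | 66°9′`",
  "`11 | 63°26′ | icosahedron less one point (nonunique)`", "`12 | 63°26′ | icosahedron`", and
  "Clearly `a_n ≤ a_{n−1}` for all `n`".
* L. Fejes [Tóth], Jber. Deutsch. Math.-Verein. 53 (1943) 66–68, (1) [`FejesToth1943Tammes`]:
  `d_n ≤ √(4 − cosec² ω_n) = √(3 − cot² ω_n)`, `ω_n = nπ/(6(n − 2))`; at `n = 9`,
  `ω₉ = 3π/14` and `cot (3π/14) = tan (2π/7)`, so the bound is `√(4 − sec² (2π/7)) = 1.19481…`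
  (angular `73°22′`; the §18 table prints `d₀² = 2,802..` for `N = 9`, i.e. `4/2.802 = 1.4276 =
  1.19481²`).

## What is proved

* `maxMinDist_succ_le`, `maxMinDist_le_of_le` — **monotonicity `d_{N+1} ≤ d_N` (`N ≥ 2`)** in
  every real normed group `E` (delete a point), the "clearly `a_n ≤ a_{n−1}`" of Croft–Falconer–Guy.
* `sqrt_le_maxMinDist_nine` — the NINE-POINT FIGURE of Fig. 24 as an explicit coefficient table
  over an orthonormal frame: `A, B, C` on the equator at azimuths `0°, ±120°`; `P, Q, R` at height
  `√5/3` (horizontal radius `2/3`) and azimuths `180°, ∓60°`; `L, M, N` their mirror images below the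
  equator.  The eighteen edges of the graph (the triangles `PQR`, `LMN` and the twelve edges from
  `A, B, C` to their four neighbours each — every point has degree `4`) have inner product EXACTLY
  `1/3 = cos a₀`; every other pair has inner product `≤ −1/9`.  Hence **`d₉ ≥ √(4/3) = 2/√3`**
  (`= 1.1547…`, angular `arccos (1/3) = 70°31′44″`; `d² = 3` as printed) in every real inner product
  space of dimension `≥ 3`; `lt_maxMinDist_nine` (`1.1547 < d₉` on `S²`), `exists_nine_sqrt_le_dist`
  (the finite-set reading).
* `maxMinDist_nine_le_sqrt`, `sqrt_three_sub_cot_sq_three_pi_div_fourteen_mem_Ioo`,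
  `maxMinDist_nine_lt` — Fejes Tóth's bound at `N = 9` evaluated: `cos (2π/7)` is pinned by its
  cubic `8c³ + 4c² − 4c − 1 = 0` (from `cos (6π/7) = cos (8π/7)`) to `(0.623489, 0.62349)`, whence
  `1.1948 < √(3 − cot² (3π/14)) < 1.1949` and **`1.1547 < d₉ < 1.1949` on `S²`**
  (`maxMinDist_nine_mem_Ioo`; the true value is the lower end, Schütte–van der Waerden §§13–16).
* `sqrt_le_maxMinDist_eleven`, `sqrt_le_maxMinDist_ten` — "icosahedron less one point" (resp. two):
  `d₁₁, d₁₀ ≥ √(2 − 2/√5) = d₁₂` in dimension `≥ 3`; `maxMinDist_twelve_le_maxMinDist_eleven`;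
  and the S² brackets `maxMinDist_ten_mem_Ioo`, `maxMinDist_eleven_mem_Ioo` :
  `1.0514 < d₁₀, d₁₁ < 1.1949` (monotonicity both ways; the printed values `66°9′`, `63°26′` —
  Danzer, Böröczky — are NOT formalised).

Everything is proved; no definitions, no named facts.

## References
* K. Schütte, B. L. van der Waerden, *Auf welcher Kugel haben 5, 6, 7, 8 oder 9 Punkte mit
  Mindestabstand Eins Platz?*, Math. Ann. 123 (1951) 96–124: §12 p. 110 (Fig. 24,
  `cos α₀ = ¼, cos a₀ = ⅓, r₀ = ½√3`), §17 p. 122 (`N = 11, 12`), §18 table p. 124.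
  [`SchutteVanderwaerden1951`]
* H. T. Croft, K. J. Falconer, R. K. Guy, *Unsolved Problems in Geometry* (1991), §D7 p. 129.
  [`CroftFalconerGuy1991`]
* L. Fejes [Tóth], Jber. Deutsch. Math.-Verein. 53 (1943) 66–68, (1). [`FejesToth1943Tammes`]
* O. R. Musin, A. S. Tarasov, Proc. Steklov Inst. Math. 288 (2015) 117–131, Table 7.4
  (`N = 9`: maximal graph no. 7, `d_max = 1.23096` rad `= arccos (1/3)`). [`MusinTarasov2015`]
-/

noncomputable section

namespace Literature.Geometry.DiscreteGeometry

open RealInnerProductSpace Module Finset Real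

universe u

/-! ### Monotonicity in `N`: deleting a point -/

section Monotone

variable {E : Type u} [NormedAddCommGroup E]

/-- **`d_{N+1} ≤ d_N` for `N ≥ 2`** ("Clearly `a_n ≤ a_{n−1}` for all `n`"): forgetting the last
point of a configuration of `N + 1` points of the unit sphere does not decrease its minimum
distance.  (For `N = 1` the statement fails in this formalisation: `d₁ = 0 < d₂ = 2`, the minimum
over no pairs being `0`.)  Any real normed group `E`.
[cite: CroftFalconerGuy1991, §D7 p. 129 ("Clearly a_n ≤ a_{n-1} for all n")] -/
theorem maxMinDist_succ_le {N : ℕ} (hN : 2 ≤ N) : maxMinDist (N + 1) E ≤ maxMinDist N E := by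
  rw [maxMinDist]
  refine Real.sSup_le ?_ (Real.sSup_nonneg ?_)
  · rintro _ ⟨x, hx, rfl⟩
    have hy : (fun i : Fin N => x (Fin.castSucc i)) ∈ unitConfigs N E := fun i => hx _
    have hne : (distinctPairs N).Nonempty :=
      distinctPairs_nonempty (i := ⟨0, by omega⟩) (j := ⟨1, by omega⟩) (by simp [Fin.ext_iff])
    refine le_trans ?_ (minDist_le_maxMinDist hy)
    exact le_minDist _ hne fun i j hij =>
      minDist_le_dist x ((Fin.castSucc_injective N).ne hij)
  · rintro _ ⟨x, -, rfl⟩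
    exact minDist_nonneg x

/-- **`d_M ≤ d_N` for `2 ≤ N ≤ M`.**
[cite: CroftFalconerGuy1991, §D7 p. 129 ("Clearly a_n ≤ a_{n-1} for all n")] -/
theorem maxMinDist_le_of_le {N M : ℕ} (hN : 2 ≤ N) (hNM : N ≤ M) :
    maxMinDist M E ≤ maxMinDist N E := by
  induction M, hNM using Nat.le_induction with
  | base => exact le_rfl
  | succ M hNM ih => exact (maxMinDist_succ_le (by omega)).trans ih

end Monotone

/-! ### `N = 9`: the figure of Fig. 24 (`cos a₀ = 1/3`) -/

section Nine

variable {E : Type u} [NormedAddCommGroup E] [InnerProductSpace ℝ E]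

/-- `(√3/2)² = 3/4`. [folklore] -/
private theorem sqrt_three_half_mul_self : Real.sqrt 3 / 2 * (Real.sqrt 3 / 2) = 3 / 4 := by
  have h : Real.sqrt 3 * Real.sqrt 3 = 3 := Real.mul_self_sqrt (by norm_num)
  linear_combination (1 / 4 : ℝ) * h

/-- `(√3/3)² = 1/3`. [folklore] -/
private theorem sqrt_three_third_mul_self : Real.sqrt 3 / 3 * (Real.sqrt 3 / 3) = 1 / 3 := by
  have h : Real.sqrt 3 * Real.sqrt 3 = 3 := Real.mul_self_sqrt (by norm_num)
  linear_combination (1 / 9 : ℝ) * h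

/-- `(√3/2)(√3/3) = 1/2`. [folklore] -/
private theorem sqrt_three_half_mul_third : Real.sqrt 3 / 2 * (Real.sqrt 3 / 3) = 1 / 2 := by
  have h : Real.sqrt 3 * Real.sqrt 3 = 3 := Real.mul_self_sqrt (by norm_num)
  linear_combination (1 / 6 : ℝ) * h

/-- `(√5/3)² = 5/9`. [folklore] -/
private theorem sqrt_five_third_mul_self : Real.sqrt 5 / 3 * (Real.sqrt 5 / 3) = 5 / 9 := by
  have h : Real.sqrt 5 * Real.sqrt 5 = 5 := Real.mul_self_sqrt (by norm_num)
  linear_combination (1 / 9 : ℝ) * h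

set_option maxHeartbeats 400000 in
-- `9 + 72` `fin_cases` branches, each a `simp` + `linarith` call: the default `200000` times out.
/-- **The nine-point figure of Fig. 24** (`cos a₀ = ⅓`): with `h = √3/2`, `g = √3/3`, `f = √5/3`,
the nine unit vectors `A = (1, 0, 0)`, `B, C = (−½, ±h, 0)` (the equator), `P = (−⅔, 0, f)`,
`Q, R = (⅓, ∓g, f)` (the upper triangle) and `L = (−⅔, 0, −f)`, `M, N = (⅓, ∓g, −f)` (the lower
triangle) over an orthonormal frame have pairwise inner products `≤ ⅓`, with equality exactly
along the `18` edges of the graph of Fig. 24 (all nine points of degree `4`: the triangles `PQR`,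
`LMN`, and `A, B, C` joined to two upper and two lower points each); hence
`d₉ ≥ √(2 − 2/3) = √(4/3) = 2/√3` (`= 1.1547…`; angular `a₀ = arccos ⅓ = 70°31′44″`; `r₀ = ½√3`,
`d² = 3` as printed) in every real inner product space of dimension `≥ 3`.
[cite: SchutteVanderwaerden1951, §12 p. 110 (Fig. 24, cos a₀ = 1/3, r₀ = ½√3) and §18 table (N = 9: d² = 3)] -/
theorem sqrt_le_maxMinDist_nine [FiniteDimensional ℝ E] (h3 : 3 ≤ finrank ℝ E) :
    Real.sqrt (4 / 3) ≤ maxMinDist 9 E := by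
  set h := Real.sqrt 3 / 2 with hh_def
  set g := Real.sqrt 3 / 3 with hg_def
  set f := Real.sqrt 5 / 3 with hf_def
  have hh : h * h = 3 / 4 := sqrt_three_half_mul_self
  have hg : g * g = 1 / 3 := sqrt_three_third_mul_self
  have hhg : h * g = 1 / 2 := sqrt_three_half_mul_third
  have hgh : g * h = 1 / 2 := by rw [mul_comm]; exact sqrt_three_half_mul_third
  have hf : f * f = 5 / 9 := sqrt_five_third_mul_self
  have key := sqrt_le_maxMinDist_of_table (E := E) h3 (by norm_num : 2 ≤ 9)
    ![![1, 0, 0], ![-(1 / 2), h, 0], ![-(1 / 2), -h, 0],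
      ![-(2 / 3), 0, f], ![1 / 3, -g, f], ![1 / 3, g, f],
      ![-(2 / 3), 0, -f], ![1 / 3, -g, -f], ![1 / 3, g, -f]] (1 / 3)
    (fun k => by fin_cases k <;> simp [Fin.sum_univ_three] <;> linarith [hh, hg, hf])
    (fun k l hkl => by
      fin_cases k <;> fin_cases l <;>
        first
        | exact absurd rfl hkl
        | (simp [Fin.sum_univ_three] <;> linarith [hh, hg, hhg, hgh, hf]))
  rwa [show (2 : ℝ) - 2 * (1 / 3) = 4 / 3 by norm_num] at key

/-- The same bound written as `2/√3 ≤ d₉` (`2/d` with `d² = 3`, the printed normalisation).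
[cite: SchutteVanderwaerden1951, §12 p. 110 and §18 table (N = 9: d² = 3)] -/
theorem two_div_sqrt_three_le_maxMinDist_nine [FiniteDimensional ℝ E] (h3 : 3 ≤ finrank ℝ E) :
    2 / Real.sqrt 3 ≤ maxMinDist 9 E := by
  have h := sqrt_le_maxMinDist_nine (E := E) h3
  rwa [show (4 : ℝ) / 3 = 2 ^ 2 / 3 by norm_num, Real.sqrt_div' _ (by norm_num : (0 : ℝ) ≤ 3),
    Real.sqrt_sq (by norm_num : (0 : ℝ) ≤ 2)] at h

/-- **`1.1547 < d₉`** on `S² ⊂ ℝ³` (`√(4/3) = 1.1547005…`).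
[cite: SchutteVanderwaerden1951, §12 p. 110 and §18 table p. 124 (N = 9: d² = 3)]
[cite: CroftFalconerGuy1991, §D7 table (9 | 70°32′)] -/
theorem lt_maxMinDist_nine : (1.1547 : ℝ) < maxMinDist 9 (EuclideanSpace ℝ (Fin 3)) := by
  refine lt_of_lt_of_le ?_ (sqrt_le_maxMinDist_nine (by rw [finrank_euclideanSpace_fin]))
  exact (Real.lt_sqrt (by norm_num)).2 (by norm_num)

/-- **Finite-set reading**: there are nine points of the unit sphere of `ℝ³` with pairwise
(chordal) distances `≥ √(4/3)` (angular `≥ arccos ⅓ = 70°31′44″`) — "Wir erhalten so eine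
störungsfreie Lagerung von 9 Punkten auf einer Kugel (Fig. 24)".
[cite: SchutteVanderwaerden1951, §12 p. 110] -/
theorem exists_nine_sqrt_le_dist :
    ∃ T : Finset (EuclideanSpace ℝ (Fin 3)), T.card = 9 ∧ (∀ v ∈ T, ‖v‖ = 1) ∧
      ∀ v ∈ T, ∀ w ∈ T, v ≠ w → Real.sqrt (4 / 3) ≤ dist v w := by
  obtain ⟨x, hx, hxd⟩ := exists_minDist_eq_maxMinDist (E := EuclideanSpace ℝ (Fin 3)) 9
  have hle : Real.sqrt (4 / 3) ≤ minDist x := by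
    rw [hxd]
    exact sqrt_le_maxMinDist_nine (by rw [finrank_euclideanSpace_fin])
  have hne : (distinctPairs 9).Nonempty := distinctPairs_nonempty (i := 0) (j := 1) (by decide)
  exact exists_finset_of_le_minDist hx hne (Real.sqrt_pos.2 (by norm_num)) hle

end Nine

/-! ### Fejes Tóth's bound at `N = 9`: `ω₉ = 3π/14`, `cot (3π/14) = tan (2π/7)` -/

section NineUpper

/-- The cubic of `cos (2π/7)`: `8c³ + 4c² − 4c − 1 = 0` (from `cos (3·2π/7) = cos (4·2π/7)`,
i.e. `4c³ − 3c = 8c⁴ − 8c² + 1`, divided by `c − 1 ≠ 0`). [folklore] -/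
private theorem cos_two_pi_div_seven_cubic :
    8 * Real.cos (2 * π / 7) ^ 3 + 4 * Real.cos (2 * π / 7) ^ 2 - 4 * Real.cos (2 * π / 7) - 1
      = 0 := by
  set c := Real.cos (2 * π / 7) with hc
  have h34 : Real.cos (3 * (2 * π / 7)) = Real.cos (2 * (2 * (2 * π / 7))) := by
    rw [show 2 * (2 * (2 * π / 7)) = 2 * π - 3 * (2 * π / 7) by ring, Real.cos_two_pi_sub]
  rw [Real.cos_three_mul, Real.cos_two_mul, Real.cos_two_mul, ← hc] at h34
  have hc1 : c < 1 := by
    rw [hc, ← Real.cos_zero]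
    exact Real.cos_lt_cos_of_nonneg_of_le_pi le_rfl (by linarith [pi_pos]) (by positivity)
  have hprod : (c - 1) * (8 * c ^ 3 + 4 * c ^ 2 - 4 * c - 1) = 0 := by
    linear_combination (-1 : ℝ) * h34
  rcases mul_eq_zero.1 hprod with h0 | h0
  · exact absurd (sub_eq_zero.1 h0) (ne_of_lt hc1)
  · exact h0

/-- `cos (2π/7) > cos 60° = 1/2`. [folklore] -/
private theorem one_half_lt_cos_two_pi_div_seven : (1 / 2 : ℝ) < Real.cos (2 * π / 7) := by
  rw [← Real.cos_pi_div_three]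
  exact Real.cos_lt_cos_of_nonneg_of_le_pi (by positivity) (by linarith [pi_pos])
    (by linarith [pi_pos])

/-- `0.623489 < cos (2π/7)` (`cos (2π/7) = 0.6234898…`): the cubic is increasing on `[1/2, ∞)`
and still negative at `0.623489`. [folklore] -/
private theorem lt_cos_two_pi_div_seven : (0.623489 : ℝ) < Real.cos (2 * π / 7) := by
  have h3 := cos_two_pi_div_seven_cubic
  have h12 := one_half_lt_cos_two_pi_div_seven
  set c := Real.cos (2 * π / 7) with hc
  by_contra hle
  push Not at hle
  have hq : 0 ≤ 8 * (c ^ 2 + c * 0.623489 + 0.623489 ^ 2) + 4 * (c + 0.623489) - 4 := by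
    nlinarith
  nlinarith [mul_nonneg (sub_nonneg.2 hle) hq]

/-- `cos (2π/7) < 0.62349`. [folklore] -/
private theorem cos_two_pi_div_seven_lt : Real.cos (2 * π / 7) < 0.62349 := by
  have h3 := cos_two_pi_div_seven_cubic
  have h12 := one_half_lt_cos_two_pi_div_seven
  set c := Real.cos (2 * π / 7) with hc
  by_contra hle
  push Not at hle
  have hq : 0 ≤ 8 * (c ^ 2 + c * 0.62349 + 0.62349 ^ 2) + 4 * (c + 0.62349) - 4 := by
    nlinarith
  nlinarith [mul_nonneg (sub_nonneg.2 hle) hq]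

/-- `cot (3π/14) = sin (2π/7) / cos (2π/7)` (`3π/14 = π/2 − 2π/7`). [folklore] -/
private theorem cot_three_pi_div_fourteen :
    Real.cot (3 * π / 14) = Real.sin (2 * π / 7) / Real.cos (2 * π / 7) := by
  rw [Real.cot_eq_cos_div_sin, show 3 * π / 14 = π / 2 - 2 * π / 7 by ring,
    Real.cos_pi_div_two_sub, Real.sin_pi_div_two_sub]

/-- `3 − cot² (3π/14) < 1.1949²` (`3 − tan² (2π/7) = 4 − sec² (2π/7) = 1.427583…`,
`1.1949² = 1.42778…`). [folklore] -/
private theorem three_sub_cot_sq_three_pi_div_fourteen_lt :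
    3 - Real.cot (3 * π / 14) ^ 2 < 1.1949 ^ 2 := by
  have hc := cos_two_pi_div_seven_lt
  have hc1 := lt_cos_two_pi_div_seven
  have hc0 : 0 < Real.cos (2 * π / 7) := by linarith
  have hs2 : Real.sin (2 * π / 7) ^ 2 = 1 - Real.cos (2 * π / 7) ^ 2 := Real.sin_sq _
  rw [cot_three_pi_div_fourteen, div_pow, sub_lt_comm, lt_div_iff₀ (pow_pos hc0 2), hs2]
  nlinarith [mul_lt_mul'' hc hc hc0.le hc0.le]

/-- `1.1948² < 3 − cot² (3π/14)`. [folklore] -/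
private theorem lt_three_sub_cot_sq_three_pi_div_fourteen :
    1.1948 ^ 2 < 3 - Real.cot (3 * π / 14) ^ 2 := by
  have hc := lt_cos_two_pi_div_seven
  have hc0 : 0 < Real.cos (2 * π / 7) := by linarith
  have hs2 : Real.sin (2 * π / 7) ^ 2 = 1 - Real.cos (2 * π / 7) ^ 2 := Real.sin_sq _
  rw [cot_three_pi_div_fourteen, div_pow, lt_sub_comm, div_lt_iff₀ (pow_pos hc0 2), hs2]
  nlinarith [mul_lt_mul'' hc hc (by norm_num) (by norm_num)]

/-- **Fejes Tóth's bound at `N = 9`**: `d₉ ≤ √(3 − cot² (3π/14))` (`ω₉ = 9π/(6·7) = 3π/14`).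
[cite: FejesToth1943Tammes, (1) p. 66, n = 9] -/
theorem maxMinDist_nine_le_sqrt :
    maxMinDist 9 (EuclideanSpace ℝ (Fin 3)) ≤ Real.sqrt (3 - Real.cot (3 * π / 14) ^ 2) := by
  have h := maxMinDist_le_fejesToth (N := 9) (by norm_num)
  rwa [show ((9 : ℕ) : ℝ) * π / (6 * ((9 : ℕ) - 2)) = 3 * π / 14 by push_cast; ring] at h

/-- **The numerical value of Fejes Tóth's bound for nine points**:
`1.1948 < √(3 − cot² (3π/14)) < 1.1949` (`= 1.194815…`, the chord of `73.369°`; §18 table: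
`d₀² = 2,802..` for `N = 9`, `2/√2.802 = 1.1948`).
[cite: FejesToth1943Tammes, (1) p. 66, n = 9]
[cite: SchutteVanderwaerden1951, §18 table p. 124 (N = 9: d₀² = 2,802..)] -/
theorem sqrt_three_sub_cot_sq_three_pi_div_fourteen_mem_Ioo :
    Real.sqrt (3 - Real.cot (3 * π / 14) ^ 2) ∈ Set.Ioo (1.1948 : ℝ) 1.1949 := by
  constructor
  · exact (Real.lt_sqrt (by norm_num)).2 lt_three_sub_cot_sq_three_pi_div_fourteen
  · exact (Real.sqrt_lt' (by norm_num)).2 three_sub_cot_sq_three_pi_div_fourteen_lt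

/-- **`d₉ < 1.1949`** (chordal; angular: `d₉ ≤ 73.369° < 73.38°`): Fejes Tóth's bound for nine
points, evaluated. [cite: FejesToth1943Tammes, (1) p. 66, n = 9] -/
theorem maxMinDist_nine_lt : maxMinDist 9 (EuclideanSpace ℝ (Fin 3)) < 1.1949 :=
  maxMinDist_nine_le_sqrt.trans_lt sqrt_three_sub_cot_sq_three_pi_div_fourteen_mem_Ioo.2

/-- **`1.1547 < d₉ < 1.1949` on `S²`**: Schütte–van der Waerden's figure from below, Fejes Tóth's
bound from above (the true value `√(4/3) = 1.1547…` is the lower end, §§13–16 of the 1951 paper,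
not formalised).
[cite: SchutteVanderwaerden1951, §12 p. 110 and §18 table (N = 9: d² = 3, d₀² = 2,802..)]
[cite: FejesToth1943Tammes, (1), n = 9] -/
theorem maxMinDist_nine_mem_Ioo :
    maxMinDist 9 (EuclideanSpace ℝ (Fin 3)) ∈ Set.Ioo (1.1547 : ℝ) 1.1949 :=
  ⟨lt_maxMinDist_nine, maxMinDist_nine_lt⟩

end NineUpper

/-! ### `N = 10, 11`: the icosahedron less one or two points, and the brackets -/

section TenEleven

variable {E : Type u} [NormedAddCommGroup E] [InnerProductSpace ℝ E]

/-- **`d₁₁ ≥ √(2 − 2/√5)`** ("icosahedron less one point") in every real inner product space of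
dimension `≥ 3`: the icosahedral value `d₁₂` bounds `d₁₁` from below by deleting a vertex.
Schütte–van der Waerden: the icosahedron's sphere "stellt wahrscheinlich auch die Minimalkugel
für `N = 11` dar" (the equality `d₁₁ = d₁₂`, Böröczky/Danzer, is not formalised).
[cite: CroftFalconerGuy1991, §D7 p. 129 (11 | 63°26′ | icosahedron less one point)]
[cite: SchutteVanderwaerden1951, §17 p. 122 (N = 11 und N = 12)] -/
theorem sqrt_le_maxMinDist_eleven [FiniteDimensional ℝ E] (h3 : 3 ≤ finrank ℝ E) :
    Real.sqrt (2 - 2 * (Real.sqrt 5 / 5)) ≤ maxMinDist 11 E :=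
  (sqrt_le_maxMinDist_twelve h3).trans (maxMinDist_succ_le (by norm_num))

/-- **`d₁₀ ≥ √(2 − 2/√5)`** (icosahedron less two points), dimension `≥ 3`.
[cite: CroftFalconerGuy1991, §D7 p. 129 ("Clearly a_n ≤ a_{n-1}"; 12 | 63°26′ | icosahedron)] -/
theorem sqrt_le_maxMinDist_ten [FiniteDimensional ℝ E] (h3 : 3 ≤ finrank ℝ E) :
    Real.sqrt (2 - 2 * (Real.sqrt 5 / 5)) ≤ maxMinDist 10 E :=
  (sqrt_le_maxMinDist_twelve h3).trans (maxMinDist_le_of_le (by norm_num) (by norm_num))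

/-- **`d₁₂ ≤ d₁₁` on `S²`**, with `d₁₂ = √(2 − 2/√5)` (`maxMinDist_twelve_euclideanSpace_three`).
[cite: CroftFalconerGuy1991, §D7 p. 129 (rows 11, 12)] -/
theorem maxMinDist_twelve_le_maxMinDist_eleven :
    maxMinDist 12 (EuclideanSpace ℝ (Fin 3)) ≤ maxMinDist 11 (EuclideanSpace ℝ (Fin 3)) :=
  maxMinDist_succ_le (by norm_num)

/-- **`1.0514 < d₁₁ < 1.1949` on `S²`** (`d₁₂ ≤ d₁₁ ≤ d₉`; printed value `63°26′ = d₁₂`, i.e.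
`1.05146…`, not formalised). [cite: CroftFalconerGuy1991, §D7 p. 129 (11 | 63°26′)] -/
theorem maxMinDist_eleven_mem_Ioo :
    maxMinDist 11 (EuclideanSpace ℝ (Fin 3)) ∈ Set.Ioo (1.0514 : ℝ) 1.1949 :=
  ⟨maxMinDist_twelve_mem_Ioo.1.trans_le maxMinDist_twelve_le_maxMinDist_eleven,
    (maxMinDist_le_of_le (E := EuclideanSpace ℝ (Fin 3)) (N := 9) (by norm_num)
      (by norm_num)).trans_lt maxMinDist_nine_lt⟩

/-- **`1.0514 < d₁₀ < 1.1949` on `S²`** (`d₁₂ ≤ d₁₀ ≤ d₉`; printed value `66°9′`, Danzer, not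
formalised). [cite: CroftFalconerGuy1991, §D7 p. 129 (10 | 66°9′)] -/
theorem maxMinDist_ten_mem_Ioo :
    maxMinDist 10 (EuclideanSpace ℝ (Fin 3)) ∈ Set.Ioo (1.0514 : ℝ) 1.1949 :=
  ⟨maxMinDist_twelve_mem_Ioo.1.trans_le
      (maxMinDist_le_of_le (E := EuclideanSpace ℝ (Fin 3)) (N := 10) (by norm_num) (by norm_num)),
    (maxMinDist_le_of_le (E := EuclideanSpace ℝ (Fin 3)) (N := 9) (by norm_num)
      (by norm_num)).trans_lt maxMinDist_nine_lt⟩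

end TenEleven

end Literature.Geometry.DiscreteGeometry

end
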